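import Mathlib.Analysis.SpecialFunctions.Pow.Real
import Mathlib.Analysis.SpecialFunctions.Sqrt
import Literature.Computability.AlgebraicComplexity.GKSS19HardnessToHittingSets
import HarnessLib

/-!
# GKSS19 ‹Theorem 5› is the constant-`k` case of ‹Theorem 25› (relative theorem, no new facts)

Guo–Kumar–Saptharishi–Solomon, *Derandomization from algebraic hardness* (arXiv:1905.00091),
state their main theorem twice: ‹Thm 5› (§1, arXiv p0005.txt:L28-31) for a constant number of
variables `k` and hitting sets of size `poly_{δ,k}(s)`, and ‹Thm 25› (§5, p0013.txt:L4-8) for any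
non-decreasing `k(d) = o(√log d)` with hitting sets of size / running time `s^{O(k̃(s)²)}`,
`k̃(s) = k(s^{log s})`; the paper says ‹Thm 5› "is a simpler form" of ‹Thm 25› (p0013.txt:L2-3).

Both are typed as named facts in `GKSS19HardnessToHittingSets.lean`
(`GKSS2019_thm_5`, `GKSS2019_thm_25`; their proofs need `FP` machines for interpolation /
Gaussian elimination over `ℚ` and the iterated bootstrapping of §4–§5, not in the tree).
This file records, sorry-free and WITHOUT introducing any fact, that the typed ‹Thm 5› carries
no debt of its own: it follows from the typed ‹Thm 25› by specialising `k(d) := k` (constant,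
hence monotone and `o(√log d)`), reading the `O(s^{c k²} + c)`-time enumerator as an `FP` one and
the size bound `s^{c k²} + c` as `s^{c'} + c'` with `c' = c k² + c + 1`.

HONEST FRAMING: this is the bookkeeping implication between the two TYPED statements, exactly
as printed ("simpler form"); it does not prove either theorem.

## References
* [GuoKumarSaptharishiSolomon2019] Z. Guo, M. Kumar, R. Saptharishi, N. Solomon,
  Derandomization from algebraic hardness, arXiv:1905.00091 / SIAM J. Comput. 51 (2022);
  Thm 5 (arXiv p.5), Thm 25 (arXiv p.13).
* [AroraBarak2009] S. Arora, B. Barak, Computational Complexity, §1.2 / Def. 1.12–1.13 (`FTIME`, `FP`).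
-/

noncomputable section

open Filter
open Literature.Computability.Complexity

namespace Literature.Computability.AlgebraicComplexity

namespace GKSS2019

/-- A string function computable in time `O(n^e + a)` is polynomial-time (`FTIME (n^e + a) ⊆ FP`).
[cite: AroraBarak2009, Def. 1.12–1.13 (FP = ⋃_c FTIME(n^c))] -/
theorem mem_FP_of_mem_FTIME_pow_add {e a : ℕ} {f : List Bool → List Bool}
    (hf : f ∈ FTIME (fun n => n ^ e + a)) : f ∈ FP := by
  obtain ⟨c, hc⟩ := hf
  refine ⟨Polynomial.C c * Polynomial.X ^ e + Polynomial.C (c * a + c), hc.mono fun n => ?_⟩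
  simp only [Polynomial.eval_add, Polynomial.eval_mul, Polynomial.eval_C, Polynomial.eval_pow,
    Polynomial.eval_X]
  exact le_of_eq (by ring)

/-- Point lists enumerable in time `O(s^e + a)` on input `1^s` are an explicit (`FP`-enumerable)
family of point sets. [cite: GuoKumarSaptharishiSolomon2019, §1.2 (arXiv p0006.txt:L28 "enumerated by a deterministic Turing machine in time poly(s)")] -/
theorem IsPointsInTime.isExplicitPoints_of_pow_add {e a : ℕ} {H : ℕ → List (List ℚ)}
    (h : IsPointsInTime (fun s => s ^ e + a) H) : IsExplicitPoints H := by
  obtain ⟨g, hg, hgH⟩ := h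
  exact ⟨g, mem_FP_of_mem_FTIME_pow_add hg, hgH⟩

/-- A constant arity profile `k(d) = k` is `o(√(log d))`: for every `ε > 0`, eventually
`k ≤ ε · √(log d)`. [folklore] [cite: GuoKumarSaptharishiSolomon2019, §5 remark before Thm 25 (arXiv p0013.txt:L2-3, "Theorem 5 ... is a simpler form")] -/
theorem const_isLittleO_sqrt_log (k : ℕ) :
    ∀ ε : ℝ, 0 < ε → ∀ᶠ d : ℕ in atTop, (k : ℝ) ≤ ε * Real.sqrt (Real.log d) := by
  intro ε hε
  have ht : Tendsto (fun d : ℕ => Real.sqrt (Real.log d)) atTop atTop :=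
    Real.tendsto_sqrt_atTop.comp (Real.tendsto_log_atTop.comp tendsto_natCast_atTop_atTop)
  filter_upwards [ht.eventually_ge_atTop ((k : ℝ) / ε)] with d hd
  rw [div_le_iff₀ hε] at hd
  simpa [mul_comm] using hd

/-- The size bound `s^{c k²} + c` of ‹Thm 25› (constant `k`) is of the shape `s^{c'} + c'` of
‹Thm 5›, with `c' = c k² + c + 1` (the `+1` absorbs `0^0 = 1` at `s = 0`). [folklore] -/
private theorem pow_add_le_pow_add (s c k : ℕ) :
    s ^ (c * k ^ 2) + c ≤ s ^ (c * k ^ 2 + c + 1) + (c * k ^ 2 + c + 1) := by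
  rcases Nat.eq_zero_or_pos s with rfl | hs
  · have h0 : (0 : ℕ) ^ (c * k ^ 2) ≤ 1 := pow_le_one₀ le_rfl zero_le_one
    have h1 : (0 : ℕ) ^ (c * k ^ 2 + c + 1) = 0 := zero_pow (by omega)
    omega
  · exact add_le_add (Nat.pow_le_pow_right hs (by omega)) (by omega)

end GKSS2019

open GKSS2019 HittingSets Literature.Barriers.ValiantsHypothesis

/-- **GKSS ‹Thm 5› from ‹Thm 25›** ("Theorem 5 ... is a simpler form of the following theorem",
arXiv p0013.txt:L2-3): the typed general theorem `GKSS2019_thm_25` (any non-decreasing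
`k(d) = o(√log d)`, hitting sets for `𝒞(s,s,s)` of size and enumeration time `s^{O(k̃(s)²)}`)
implies the typed constant-`k` main theorem `GKSS2019_thm_5` (explicit `poly_{δ,k}(s)`-size
hitting sets for `𝒞(s,s,s)`), by taking `k(d) := k`: a constant profile is monotone, positive and
`o(√log d)`; `k̃ = k`, so the `O(s^{c k²} + c)`-time enumerator is an `FP` enumerator and the size
bound is `s^{c'} + c'` with `c' = c k² + c + 1`. Relative theorem between two named facts of
`GKSS19HardnessToHittingSets.lean`; introduces no fact.
[cite: GuoKumarSaptharishiSolomon2019, Thm 5 (arXiv p0005.txt:L28-31) and Thm 25 (arXiv p0013.txt:L2-8)] -/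
theorem GKSS2019_thm_5_of_thm_25 (h25 : GKSS2019_thm_25) : GKSS2019_thm_5 := by
  intro k δ hk hδ P hP hdeg hhard
  obtain ⟨c, H, htime, hlen, hhit⟩ :=
    h25 δ (fun _ => k) hδ monotone_const (fun _ => hk) (const_isLittleO_sqrt_log k) P hP hdeg hhard
  have htime' : IsPointsInTime (fun s => s ^ (c * k ^ 2) + c) H := htime
  have hlen' : ∀ s, (H s).length ≤ s ^ (c * k ^ 2) + c := hlen
  exact ⟨H, htime'.isExplicitPoints_of_pow_add, ⟨c * k ^ 2 + c + 1, fun s =>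
    (hlen' s).trans (pow_add_le_pow_add s c k)⟩, hhit⟩

end Literature.Computability.AlgebraicComplexity

end
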